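/-
Copyright (c) 2026 the pub-hodgecm-mathlib formalisation cell (harness21).  Prover seat hodgecm-mathlib-B-p14 (g31) (Layer B′ design pen), (F11-c) «THE TYPE-(2) FRAME AT
THE INERT PLACE», part 2: the anisotropy of the `u`-line exported (architect A-p06 (g26); LEAD F0P3a-plan (g9)), 2026-09-01.
-/
import Literature.NumberTheory.Rogawski1990.UnitOrbitalIntegralInertTypeTwoFrame     -- ★ p842257 (this seat): part 1 (§1 generic lemmas, the frame with the Jacobowitz identity)
import HarnessLib

/-!
# The type-(2) frame at an inert place, II: the same package WITH `B₀(x, x) ≠ 0` (the `u`-eigenline of a matched `δ` is anisotropic)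
# (Rogawski 1990, §3.5 Prop. 3.5.2 (c) p. 29, §4.9 p. 55; Flicker 1998, §6 p. 96)

Topic `NumberTheory/Rogawski1990`; namespace `Literature.NumberTheory.Rogawski1990`.  THEOREMS ONLY (no `def`, no instance, no notation, no named fact, no `sorry`).
Cell `pub/hodgecm-mathlib`, crux H413 = `stmt-HodgeConjecture-24833`, line «N7nsCount» ED. 1.5, value stubs `stub_irredGValuePos∕Neg`.  ★ part 1 `exists_typeTwo_frame`
reads `κ_v(γ_H, δ)` off the PARITY of `ord_w B₀(x, x)` but does not export `B₀(x, x) ≠ 0`; a closer needs it to turn «κ = −1» into «`ord_w B₀(x,x)` is ODD» (resp.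
«κ = +1» into «even»).  **`exists_typeTwo_frame_anisotropic`** = the same statement with the extra conjunct `B₀(x, x) ≠ 0` (the `u`-line is anisotropic: its `H′_v`-value is
a unit, ★ `isUnit_finColumnFormValue_of_col_ne_zero` — «the eigenvalue `u` is simple»), same proof.
HONEST LABEL: HC_CM is proved only modulo the printed citations until rung 0 closes; structure theory feeding TWO value stubs of #103-ns, pays nothing by itself.

## References
* [Rogawski1990] J. D. Rogawski, *Automorphic Representations of Unitary Groups in Three Variables* (1990), §3.5 Prop. 3.5.2 (c) p. 29, §4.9 Prop. 4.9.1 (b) p. 55,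
  §14.2 p. 233, §14.6 p. 242.
* [Flicker1998UnitaryFL] Y. Z. Flicker, *Elementary proof of the fundamental lemma for a unitary group*, Canad. J. Math. 50 (1998), §2 pp. 77–79, Prop. 5 p. 82, §6 p. 96.
-/

set_option autoImplicit false

noncomputable section

open MeasureTheory Measure NumberField IsDedekindDomain Matrix Polynomial
open scoped MatrixGroups ValuativeRel

namespace Literature.NumberTheory.Rogawski1990

open Literature.NumberTheory.Automorphic Literature.NumberTheory.Automorphic.UnitaryGroup
open Literature.NumberTheory.Automorphic.IntegralReduction Literature.NumberTheory.GaloisRepresentations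
open Literature.NumberTheory.Automorphic.HermitianLattice (unitaryInt B₀ B₀_apply)

section Frame

variable (L : Type) [Field L] [NumberField L] [IsCMField L] (H' : Matrix (Fin 3) (Fin 3) L) {v : HeightOneSpectrum (𝓞 ↥(maximalRealSubfield L))}

set_option synthInstance.maxHeartbeats 200000 in  -- the coset action `U_w ↷ U_w ⧸ unitaryInt` (as in ★ `FixedCosetsTransport`)
set_option maxHeartbeats 400000 in  -- 2× default: one declaration assembling frame + eigenvector + κ-parity + socket (the statement alone is ~150 lines of binders)
open scoped Classical in
/-- **THE TYPE-(2) FRAME AT AN INERT PLACE, WITH THE ANISOTROPY OF THE `u`-LINE** (the ★ part-1 package plus `B₀(x, x) ≠ 0` — the `u`-eigenline of a matched `δ` is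
anisotropic, ★ `isUnit_finColumnFormValue_of_col_ne_zero` — so that `κ = −1` FORCES `ord_w B₀(x,x)` odd and `κ = +1` forces it even).  (Both signs.)  At a finite place `v` non-split and unramified in `L`, of good reduction for the hermitian invertible `H′`, with
`m_G` canonical and `ν_G(K′) = 1`: for a `G`-regular `γ_H` with `χ_g(u)` a unit and a matched `δ ∈ G′_v` (`IsLocalNormPair γ_H δ`), there are
`T ∈ GL₃(𝒪_w)` with `H′_w = ᵗσ(T) Φ₃ T`, the frame image `t ∈ U_w = U(σ_w, Φ₃)(L_w)` of `δ` (`t = T δ_w T⁻¹`) and `x ∈ L_w³`, `x ≠ 0`, with: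
`t x = u_w x`; `tr t = tr g_w + u_w`, `det t = det g_w · u_w`; **`κ_v(γ_H, δ) = +1` if `v_w(B₀(x,x)) = exp(2k)`, `−1` if `= exp(2k+1)`** (the parity of `ord_w B₀(x,x)`);
`CompactSpace Z(t) → CompactSpace Z(δ)` (★ `compactSpace_centralizer_of_continuousMulEquiv`), and **`CompactSpace Z(δ) → Φ(⟦δ⟧, 1_{K′}) = #{y ∈ U_w ⧸ K₀ : t·y = y}`**.
(`x` is a column of the eigenline projector `P_v` read at `w`, moved by `T`.)
[cite: Rogawski1990, §4.9 Prop. 4.9.1 (b) p. 55; §14.6 p. 242; §14.2 p. 233] [cite: Flicker1998UnitaryFL, §2 pp. 77–79; Prop. 5 p. 82; §6 p. 96] -/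
theorem exists_typeTwo_frame_anisotropic (hH' : (H'.map (IsCMField.complexConj L))ᵀ = H') (hH'u : IsUnit H')
    (w : PlacesOver L v) (hw : IsCMField.complexConj L • w.1 = w.1) (hv : Algebra.IsUnramifiedIn (𝓞 L) v.asIdeal)
    (hH'w : IsUnit (placeForm H' w.1)) (hH'i : hH'w.unit ∈ glInt 3 (w.1.adicCompletion L))
    [MeasurableSpace ((cmDatum L 3 H').Local v)] [BorelSpace ((cmDatum L 3 H').Local v)]
    [∀ γ : ((cmDatum L 3 H').Local v), MeasurableSpace (((cmDatum L 3 H').Local v) ⧸ Subgroup.centralizer ({γ} : Set ((cmDatum L 3 H').Local v)))]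
    [∀ γ : ((cmDatum L 3 H').Local v), BorelSpace (((cmDatum L 3 H').Local v) ⧸ Subgroup.centralizer ({γ} : Set ((cmDatum L 3 H').Local v)))]
    (νG : Measure ((cmDatum L 3 H').Local v)) [νG.IsHaarMeasure] [νG.IsMulRightInvariant]
    {mG : OrbitalMeasureFamily ((cmDatum L 3 H').Local v)}
    (hmG : mG.IsCanonical (fun γ => IsRegularElt (γ.val : GL (Fin 3) (UnitaryGroup.LocalRing L v))) νG)
    (hνG : νG (cmLocalIntegralLevel L 3 H' v : Set ((cmDatum L 3 H').Local v)) = 1)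
    {γH : (cmDatum L 2 (Matrix.of fun i j : Fin 2 => if i.val + j.val + 1 = 2 then (1 : L) else 0)).Local v ×
      (cmDatum L 1 (Matrix.of fun i j : Fin 1 => if i.val + j.val + 1 = 1 then (1 : L) else 0)).Local v}
    (hreg : IsLocalGRegular L v γH) (hu : IsUnit ((finCharpolyTwo L v γH).eval (finGammaTwo L v γH)))
    (δ : (cmDatum L 3 H').Local v) (h : IsLocalNormPair L H' v γH δ) :
    ∃ (T : GL (Fin 3) (w.1.adicCompletion L))
      (t : ↥(unitaryGroupOfForm (galAdicCompletionMap (L := L) (IsCMField.complexConj L) hw)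
        (placeForm (Matrix.of fun i j : Fin 3 => if i.val + j.val + 1 = 3 then (1 : L) else 0) w.1)))
      (x : Fin 3 → w.1.adicCompletion L),
      T ∈ glInt 3 (w.1.adicCompletion L) ∧
      placeForm H' w.1 = formCongr (galAdicCompletionMap (L := L) (IsCMField.complexConj L) hw) T ((StdForm.antidiagonal 3).over (w.1.adicCompletion L)) ∧
      ((t : GL (Fin 3) (w.1.adicCompletion L)) =
        T * ((localNonsplitEquiv (IsCMField.complexConj L) H' (IsCMField.complexConj_ne_one L) w hw δ).val : GL (Fin 3) (w.1.adicCompletion L)) * T⁻¹) ∧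
      ((t : GL (Fin 3) (w.1.adicCompletion L)) : Matrix (Fin 3) (Fin 3) (w.1.adicCompletion L)) *ᵥ x = finGammaTwo L v γH w • x ∧ x ≠ 0 ∧
      B₀ (galAdicCompletionMap (L := L) (IsCMField.complexConj L) hw) 3 x x ≠ 0 ∧
      ((t : GL (Fin 3) (w.1.adicCompletion L)) : Matrix (Fin 3) (Fin 3) (w.1.adicCompletion L)).trace =
        (((γH.1.val : GL (Fin 2) (LocalRing L v)).val.map (Pi.evalRingHom (fun w' : PlacesOver L v => w'.1.adicCompletion L) w)).trace) +
          finGammaTwo L v γH w ∧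
      ((t : GL (Fin 3) (w.1.adicCompletion L)) : Matrix (Fin 3) (Fin 3) (w.1.adicCompletion L)).det =
        (((γH.1.val : GL (Fin 2) (LocalRing L v)).val.map (Pi.evalRingHom (fun w' : PlacesOver L v => w'.1.adicCompletion L) w)).det) *
          finGammaTwo L v γH w ∧
      (∀ k : ℤ, Valued.v (B₀ (galAdicCompletionMap (L := L) (IsCMField.complexConj L) hw) 3 x x) = WithZero.exp (2 * k) → finKappaAt L v H' γH δ = 1) ∧
      (∀ k : ℤ, Valued.v (B₀ (galAdicCompletionMap (L := L) (IsCMField.complexConj L) hw) 3 x x) = WithZero.exp (2 * k + 1) → finKappaAt L v H' γH δ = -1) ∧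
      (CompactSpace ↥(Subgroup.centralizer ({t} : Set ↥(unitaryGroupOfForm (galAdicCompletionMap (L := L) (IsCMField.complexConj L) hw)
          (placeForm (Matrix.of fun i j : Fin 3 => if i.val + j.val + 1 = 3 then (1 : L) else 0) w.1)))) →
        CompactSpace ↥(Subgroup.centralizer ({δ} : Set ((cmDatum L 3 H').Local v)))) ∧
      (CompactSpace ↥(Subgroup.centralizer ({δ} : Set ((cmDatum L 3 H').Local v))) →
        classOrbitalIntegral mG ((cmLocalIntegralLevel L 3 H' v : Set ((cmDatum L 3 H').Local v)).indicator fun _ => (1 : ℂ)) (ConjClasses.mk δ) =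
          (Nat.card {y : ↥(unitaryGroupOfForm (galAdicCompletionMap (L := L) (IsCMField.complexConj L) hw)
              (placeForm (Matrix.of fun i j : Fin 3 => if i.val + j.val + 1 = 3 then (1 : L) else 0) w.1)) ⧸
            unitaryInt (galAdicCompletionMap (L := L) (IsCMField.complexConj L) hw)
              (placeForm (Matrix.of fun i j : Fin 3 => if i.val + j.val + 1 = 3 then (1 : L) else 0) w.1) | t • y = y} : ℂ)) := by
  have hc1 : IsCMField.complexConj L ≠ 1 := IsCMField.complexConj_ne_one L
  have hsub : Subsingleton (PlacesOver L v) := PlacesOver.subsingleton_of_smul_eq (IsCMField.complexConj L) hc1 w hw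
  haveI : Nontrivial (UnitaryGroup.LocalRing L v) := ⟨⟨0, 1, fun h01 => zero_ne_one (congrFun h01 w)⟩⟩
  have hdet' : H'.det ≠ 0 := (Matrix.isUnit_iff_isUnit_det _ |>.1 hH'u).ne_zero
  -- the frame
  obtain ⟨T, e, hT, hJT, he, hlev, hmatch⟩ := exists_frame_formCongr_of_nonsplit L H' hH' w hw hv hH'w hH'i
  -- conjugacy with the pattern `ι(g_w, u_w)`: trace and determinant
  obtain ⟨P, hP⟩ := isConj_iff.1 ((hmatch γH δ).1 h)
  have hPM := congrArg (fun g : GL (Fin 3) (w.1.adicCompletion L) => (g : Matrix (Fin 3) (Fin 3) (w.1.adicCompletion L))) hP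
  simp only [Units.val_mul] at hPM
  obtain ⟨-, -, htr, hdet⟩ := mulVec_eq_smul_of_conj_endoGL P _ hPM
  have hg2m : ((((localNonsplitEquiv (IsCMField.complexConj L)
      (Matrix.of fun i j : Fin 2 => if i.val + j.val + 1 = 2 then (1 : L) else 0) hc1 w hw γH.1).val : GL (Fin 2) (w.1.adicCompletion L))) :
        Matrix (Fin 2) (Fin 2) (w.1.adicCompletion L)) =
      ((γH.1.val : GL (Fin 2) (LocalRing L v)).val.map (Pi.evalRingHom (fun w' : PlacesOver L v => w'.1.adicCompletion L) w)) :=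
    coe_coe_localNonsplitEquiv_apply (IsCMField.complexConj L) 2 _ hc1 w hw γH.1
  have hg1m : ((((localNonsplitEquiv (IsCMField.complexConj L)
      (Matrix.of fun i j : Fin 1 => if i.val + j.val + 1 = 1 then (1 : L) else 0) hc1 w hw γH.2).val : GL (Fin 1) (w.1.adicCompletion L))) :
        Matrix (Fin 1) (Fin 1) (w.1.adicCompletion L)) 0 0 = finGammaTwo L v γH w := by
    rw [coe_coe_localNonsplitEquiv_apply (IsCMField.complexConj L) 1 _ hc1 w hw γH.2]
    rfl
  rw [hg1m] at htr hdet
  rw [hg2m] at htr hdet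
  -- the eigenvector: a non-zero column `p′ = P_v e_j` of the eigenline projector, read at `w` and moved by `T`
  obtain ⟨i₀, j, hij⟩ : ∃ i j, finEigenlineProjector L v H' γH δ i j ≠ 0 := by
    by_contra hall
    push Not at hall
    exact finEigenlineProjector_ne_zero_of_isUnit L v H' γH δ h hu (Matrix.ext fun i j => hall i j)
  have hcol : (fun i => finEigenlineProjector L v H' γH δ i j) ≠ 0 := fun h0 => hij (congrFun h0 i₀)
  have hp' := localMatrix_mulVec_finEigenlineProjector_col L v H' γH δ h j
  have hTT : ((T⁻¹ : GL (Fin 3) (w.1.adicCompletion L)) : Matrix (Fin 3) (Fin 3) (w.1.adicCompletion L)) * (T : Matrix (Fin 3) (Fin 3) (w.1.adicCompletion L)) = 1 := by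
    rw [← Units.val_mul, inv_mul_cancel, Units.val_one]
  -- `δ_w y = u_w y` for `y = p′` read at `w`
  have hδw : ((δ.val.val : Matrix (Fin 3) (Fin 3) (LocalRing L v)).map (Pi.evalRingHom (fun w' : PlacesOver L v => w'.1.adicCompletion L) w)) *ᵥ
        (fun i => finEigenlineProjector L v H' γH δ i j w) = finGammaTwo L v γH w • fun i => finEigenlineProjector L v H' γH δ i j w := by
    funext i
    have h1 := congrFun (congrFun hp' i) w
    simp only [Matrix.mulVec, dotProduct, Pi.smul_apply, smul_eq_mul] at h1 ⊢
    rw [Finset.sum_apply] at h1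
    simp only [Pi.mul_apply, Matrix.map_apply, Pi.evalRingHom_apply] at h1 ⊢
    exact h1
  have htm : (((e δ).val : GL (Fin 3) (w.1.adicCompletion L)) : Matrix (Fin 3) (Fin 3) (w.1.adicCompletion L)) =
      (T : Matrix (Fin 3) (Fin 3) (w.1.adicCompletion L)) *
        ((δ.val.val : Matrix (Fin 3) (Fin 3) (LocalRing L v)).map (Pi.evalRingHom (fun w' : PlacesOver L v => w'.1.adicCompletion L) w)) *
        ((T⁻¹ : GL (Fin 3) (w.1.adicCompletion L)) : Matrix (Fin 3) (Fin 3) (w.1.adicCompletion L)) := by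
    rw [he δ, Units.val_mul, Units.val_mul, coe_coe_localNonsplitEquiv_apply (IsCMField.complexConj L) 3 H' hc1 w hw δ]
  have hx : (((e δ).val : GL (Fin 3) (w.1.adicCompletion L)) : Matrix (Fin 3) (Fin 3) (w.1.adicCompletion L)) *ᵥ
        ((T : Matrix (Fin 3) (Fin 3) (w.1.adicCompletion L)) *ᵥ fun i => finEigenlineProjector L v H' γH δ i j w) =
      finGammaTwo L v γH w • ((T : Matrix (Fin 3) (Fin 3) (w.1.adicCompletion L)) *ᵥ fun i => finEigenlineProjector L v H' γH δ i j w) := by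
    rw [htm, Matrix.mulVec_mulVec, Matrix.mul_assoc, hTT, Matrix.mul_one, ← Matrix.mulVec_mulVec, hδw, Matrix.mulVec_smul]
  have hy0 : (fun i => finEigenlineProjector L v H' γH δ i j w) ≠ 0 := by
    intro h0
    apply hij
    funext w'
    rw [hsub.elim w' w]
    have h1 := congrFun h0 i₀
    simp only [Pi.zero_apply] at h1 ⊢
    exact h1
  have hx0 : (T : Matrix (Fin 3) (Fin 3) (w.1.adicCompletion L)) *ᵥ (fun i => finEigenlineProjector L v H' γH δ i j w) ≠ 0 := by
    intro h0
    apply hy0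
    have := congrArg (fun z => ((T⁻¹ : GL (Fin 3) (w.1.adicCompletion L)) : Matrix (Fin 3) (Fin 3) (w.1.adicCompletion L)) *ᵥ z) h0
    simpa only [Matrix.mulVec_mulVec, hTT, Matrix.one_mulVec, Matrix.mulVec_zero] using this
  -- κ-parity: `x₀ := H′_v(p′, p′) ∈ L⁺_v` is a unit (★), `σ`-fixed, and reads `B₀(x, x)` at `w`
  have hXunit := isUnit_finColumnFormValue_of_col_ne_zero L v H' γH δ hsub hdet' h hu hcol
  have hXw : finColumnFormValue L v H' γH δ j w =
      B₀ (galAdicCompletionMap (L := L) (IsCMField.complexConj L) hw) 3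
        ((T : Matrix (Fin 3) (Fin 3) (w.1.adicCompletion L)) *ᵥ fun i => finEigenlineProjector L v H' γH δ i j w)
        ((T : Matrix (Fin 3) (Fin 3) (w.1.adicCompletion L)) *ᵥ fun i => finEigenlineProjector L v H' γH δ i j w) := by
    rw [finColumnFormValue, B₀_mulVec_mulVec_eq_sum_formCongr, ← hJT, Finset.sum_apply]
    refine Finset.sum_congr rfl fun i _ => ?_
    rw [Finset.sum_apply]
    refine Finset.sum_congr rfl fun k _ => ?_
    rw [Pi.mul_apply, Pi.mul_apply, conjLocal_apply_eq_of_smul_eq (IsCMField.complexConj L) hc1 v w hw, localGram_apply_apply]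
  have hXσ : conjLocal L (IsCMField.complexConj L) v (finColumnFormValue L v H' γH δ j) = finColumnFormValue L v H' γH δ j := by
    funext w'
    rw [hsub.elim w' w, conjLocal_apply_eq_of_smul_eq (IsCMField.complexConj L) hc1 v w hw, hXw]
    exact HermitianLattice.isHermitianForm_B₀ (fun z => galAdicCompletionMap_complexConj_self L v w hw z) _ _
  obtain ⟨α, hα0, hcα, hsq⟩ := cmQuadraticGenerator_spec L
  have hθ : α * α = algebraMap ↥(maximalRealSubfield L) L (cmQuadraticGenerator L : ↥(maximalRealSubfield L)) := by rw [← sq]; exact hsq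
  obtain ⟨x₀, hx₀X⟩ := Liu2021.LemD1OfPlace.exists_toLocalRing_eq_of_conjLocal_eq L v (IsCMField.complexConj L) hcα hα0 _ hXσ
  have hx₀0 : x₀ ≠ 0 := by
    intro h0
    rw [h0, map_zero] at hx₀X
    exact hXunit.ne_zero hx₀X.symm
  have hx₀w : toPlace v w x₀ = B₀ (galAdicCompletionMap (L := L) (IsCMField.complexConj L) hw) 3
        ((T : Matrix (Fin 3) (Fin 3) (w.1.adicCompletion L)) *ᵥ fun i => finEigenlineProjector L v H' γH δ i j w)
        ((T : Matrix (Fin 3) (Fin 3) (w.1.adicCompletion L)) *ᵥ fun i => finEigenlineProjector L v H' γH δ i j w) := by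
    rw [← hXw, ← hx₀X, toLocalRing_apply]
  have hval : WithZero.log (Valued.v x₀) = WithZero.log (Valued.v (B₀ (galAdicCompletionMap (L := L) (IsCMField.complexConj L) hw) 3
        ((T : Matrix (Fin 3) (Fin 3) (w.1.adicCompletion L)) *ᵥ fun i => finEigenlineProjector L v H' γH δ i j w)
        ((T : Matrix (Fin 3) (Fin 3) (w.1.adicCompletion L)) *ᵥ fun i => finEigenlineProjector L v H' γH δ i j w))) := by
    rw [← hx₀w, Liu2021.LemD1IndexedNonVacuityInertCofinite.valued_toPlace_of_isUnramifiedIn L v hv w]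
  have hxX : UnitaryGroup.toLocalRing L v x₀ = ∑ i : Fin 3, ∑ k : Fin 3, UnitaryGroup.conjLocal L (IsCMField.complexConj L) v (finEigenlineProjector L v H' γH δ i j) *
      ((UnitaryGroup.adelicForm L 3 H').map (UnitaryGroup.adeleToLocal L v)) i k * finEigenlineProjector L v H' γH δ k j := by
    rw [hx₀X, finColumnFormValue]
  refine ⟨T, e δ, (T : Matrix (Fin 3) (Fin 3) (w.1.adicCompletion L)) *ᵥ (fun i => finEigenlineProjector L v H' γH δ i j w),
    hT, hJT, he δ, hx, hx0, ?_, htr, hdet, fun k hk => ?_, fun k hk => ?_, fun hc => ?_, fun hc => ?_⟩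
  · -- anisotropy of the `u`-line: `B₀(x, x) = ι_w(x₀) ≠ 0`
    rw [← hx₀w]
    exact fun h0 => hx₀0 ((map_eq_zero_iff _ (toPlace v w).injective).1 h0)
  · exact finKappaAt_eq_one_of_nonsplit_of_isUnramifiedIn_of_even' L v H' γH δ w hw hcα hα0 hθ hv h hu hp' hcol x₀ hx₀0 hxX
      (by rw [hval, hk, WithZero.log_exp]; exact even_two_mul k)
  · exact finKappaAt_eq_neg_one_of_nonsplit_of_isUnramifiedIn_of_odd' L v H' γH δ w hw hcα hα0 hθ hv h hu hp' hcol x₀ hx₀0 hxX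
      (by rw [hval, hk, WithZero.log_exp]; exact odd_two_mul_add_one k)
  · -- compactness of the centraliser pulls back along the frame
    haveI := hc
    exact compactSpace_centralizer_of_continuousMulEquiv e δ
  · -- the orbital integral as a fixed-coset count in the model
    haveI := hc
    have hH'c : (H'.map (cmConjRingHom L))ᵀ = H' := by
      have e1 : H'.map (cmConjRingHom L) = H'.map (IsCMField.complexConj L) := by
        ext i j; simp [Matrix.map_apply, cmConjRingHom_apply]
      rw [e1]; exact hH'
    have hregδ : IsRegularElt (δ.val : GL (Fin 3) (LocalRing L v)) := isRegularElt_of_isLocalNormPair L H' v h hreg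
    rw [classOrbitalIntegral_indicator_complex_cmLocalIntegralLevel_eq_natCard_fixedBy L 3 H' v νG hH'c hdet' hmG hνG δ hregδ,
      natCard_fixedBy_cmLocalIntegralLevel_eq_of_frame L H' w hw e hlev δ]

end Frame

end Literature.NumberTheory.Rogawski1990

end
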